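import Literature.Barriers.CriticalPhenomena.RigorousRGSmallParameterHierarchicalIsing
import Literature.Analysis.Complex.HadamardGenusZeroProofs
import Literature.NumberTheory.LFunctions.NewmanProofs
import HarnessLib

/-!
# Newman's product representation (A.1) for the hierarchical Ising trajectory —
# `HaraHattoriWatanabe2001_eqA1` discharged

Fourth companion of `RigorousRGSmallParameterProofs.lean` on the Hara–Hattori–Watanabe side. The
named fact `Literature.Barriers.CriticalPhenomena.HaraHattoriWatanabe2001_eqA1`
(`RigorousRGSmallParameterHHWReduction.lean`) transcribes HHW Appendix A, (A.1) with §2.2: for the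
law `h_N = R^N h_{I,s}` (`HierarchicalRG.traj s N`, `s ≥ 0`) of the block spin of the
four-dimensional hierarchical Ising model, "`E[e^{HX}] = e^{bH²} ∏_j (1 + H²/α_j²)` (A.1), where `b`
is a non-negative constant and `α_j` … is a positive nondecreasing sequence satisfying
`Σ_j α_j⁻² < ∞`", which the paper takes from [15] = Newman 1975, Proposition 2 ("using Hadamard's
Theorem") given the Lee–Yang property of (2.9) ([15, Theorem 1]). Here it is PROVED:

* the Lee–Yang property of `h_N` is `HierarchicalRG.hasLeeYangProperty_iterate_rgMap_isingLaw`
  (sibling file, from the tree's proved circle theorem);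
* `M(H) = E[e^{HX}]` is an even entire function with `M(0) = 1` and `|M(H)| ≤ e^{R|H|}` (sibling
  file: `mgfSum` is a finite exponential sum), so `G(w) = M(w^{1/2})` is entire of order `≤ 1/2`
  (`Literature.NumberTheory.LFunctions.Newman.differentiable_comp_cpow_half`; growth
  `R|w|^{1/2} ≤ |w|^{3/4} + R³`, `mul_sqrt_le_rpow_add_cube`);
* Hadamard's factorisation in genus zero — the tree's PROVED
  `Literature.Analysis.Complex.hadamard_genus_zero_holds` (Conway, Ch. XI, Thm. 3.4) — gives
  `G(w) = ∏ₙ (1 - bₙw)`, `Σ|bₙ| < ∞`; a non-zero `bₙ` makes `w₀ = 1/bₙ` a zero of `G`, so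
  `M(w₀^{1/2}) = 0`, so `Re w₀^{1/2} = 0` (Lee–Yang), so `w₀ = (w₀^{1/2})² < 0`: every `bₙ` is a
  non-positive real `-βₙ`, and `M(H) = G(H²) = ∏ₙ (1 + βₙH²) = ∏_{βₙ ≠ 0} (1 + H²/α_n²)` with
  `αₙ = βₙ^{-1/2} > 0`, `Σ αₙ⁻² = Σ βₙ ≤ Σ |bₙ| < ∞`, and `b = 0` in (A.1)
  (`HierarchicalRG.exists_newmanRepr_iterate`, for general `0 < c ≤ 2`, `s ≥ 0`).

Hence `HaraHattoriWatanabe2001_eqA1_holds`. (Newman's Proposition 2 allows `b ≥ 0` because his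
class contains Gaussian factors; for the finitely supported `h_N` the Gaussian factor is absent,
as the order-`½` bound shows.) After this file the unproved leaves of
`RigorousRGSmallParameterNarrow` are `LongRangePhi4.Slade2017_criticalCurve`,
`HaraHattoriWatanabe2001_thm21` and `HaraHattoriWatanabe2001_thm22`.
-/

noncomputable section

namespace Literature.Barriers.CriticalPhenomena

open _root_.MeasureTheory _root_.Filter _root_.Set
open _root_.Complex (I)
open scoped _root_.Topology

namespace HierarchicalRG

open Literature.NumberTheory.LFunctions.Newman Literature.Probability.LatticeModels

/-- The growth comparison behind "order `≤ 1/2 < 3/4`": `R t^{1/2} ≤ t^{3/4} + R³` for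
`R, t ≥ 0`. [folklore] -/
theorem mul_sqrt_le_rpow_add_cube {R t : ℝ} (hR : 0 ≤ R) (ht : 0 ≤ t) :
    R * t ^ (2⁻¹ : ℝ) ≤ t ^ (3 / 4 : ℝ) + R ^ 3 := by
  have key := mul_le_mul_sqrt_add_cube (Real.rpow_nonneg ht 2⁻¹) hR
  -- key : t^(1/2) * R ≤ t^(1/2) * √(t^(1/2)) + R^3
  have e : t ^ (2⁻¹ : ℝ) * Real.sqrt (t ^ (2⁻¹ : ℝ)) = t ^ (3 / 4 : ℝ) := by
    rw [Real.sqrt_eq_rpow, ← Real.rpow_mul ht, ← Real.rpow_add' ht]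
    · norm_num
    · norm_num
  rw [mul_comm]
  linarith [key, e.le, e.ge]

/-- **Newman's product representation for the hierarchical Ising trajectory** (general
`0 < c ≤ 2`, `s ≥ 0`), from Hadamard's genus-zero factorisation `hH` and the Lee–Yang property:
`∫ e^{Hx} d(R^N h_{I,s})(x) = ∏_j (1 + H²/α_j²)` with `α_j > 0`, `Σ_j α_j⁻² < ∞` (no Gaussian
factor). "It is shown in [15, Proposition 2] using Hadamard's Theorem that `E[e^{HX}]` has a
following expression …" [cite: HaraHattoriWatanabe2001, Appendix A eq. (A.1)]
[cite: Newman1975, Proposition 2] -/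
theorem exists_newmanRepr_iterate (hH : Literature.Analysis.Complex.hadamard_genus_zero)
    (c s : ℝ) (hc : 0 < c) (hc2 : c ≤ 2) (hs : 0 ≤ s) (N : ℕ) :
    ∃ (ι : Type) (α : ι → ℝ), (∀ j, 0 < α j) ∧ Summable (fun j => (α j ^ 2)⁻¹) ∧
      ∀ z : ℂ, ∫ x, Complex.exp (z * x) ∂((rgMap c)^[N] (IsingStrongCouplingLimit.isingLaw s)) =
        ∏' j, (1 + (z / α j) ^ 2) := by
  -- the moment generating function `M` and its properties
  set Z : ℝ := partitionZ c s N with hZdef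
  have hZ : 0 < Z := partitionZ_pos c s N
  set M : ℂ → ℂ := fun z => mgfSum c s N z / Z with hM
  have hint : ∀ z : ℂ,
      ∫ x, Complex.exp (z * x) ∂((rgMap c)^[N] (IsingStrongCouplingLimit.isingLaw s)) = M z :=
    fun z => integral_cexp_iterate_rgMap_isingLaw c s N z
  have hMdiff : Differentiable ℂ M := (differentiable_mgfSum c s N).div_const _
  have hMeven : ∀ z, M (-z) = M z := fun z => by simp only [hM, mgfSum_neg]
  have hM0 : M 0 = 1 := by
    simp only [hM, mgfSum_zero]; exact div_self (Complex.ofReal_ne_zero.2 hZ.ne')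
  set R : ℝ := (Real.sqrt c / 2) ^ N * |s| * Fintype.card (Addr N) with hRdef
  have hR : 0 ≤ R := by positivity
  have hMbound : ∀ z, ‖M z‖ ≤ Real.exp (R * ‖z‖) := by
    intro z
    rw [hM]
    simp only
    rw [norm_div, Complex.norm_real, Real.norm_of_nonneg hZ.le, div_le_iff₀ hZ, mul_comm]
    exact norm_mgfSum_le c s N z
  have hLY : ∀ z, M z = 0 → z.re = 0 := by
    intro z hz
    have h := hasLeeYangProperty_iterate_rgMap_isingLaw c s hc hc2 hs N
    exact h z (by rw [hint]; exact hz)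
  -- the even lift `G(w) = M(w^{1/2})`, entire of order `≤ 3/4`
  set G : ℂ → ℂ := fun w => M (w ^ (2⁻¹ : ℂ)) with hG
  have hGdiff : Differentiable ℂ G := differentiable_comp_cpow_half hMdiff hMeven
  have hG0 : G 0 = 1 := by
    simp only [hG, Complex.zero_cpow (by norm_num : (2⁻¹ : ℂ) ≠ 0)]; exact hM0
  have hGsq : ∀ z, G (z ^ 2) = M z := fun z => comp_cpow_half_apply_sq hMeven z
  have hGbound : ∀ w, ‖G w‖ ≤ Real.exp (R ^ 3) * Real.exp (‖w‖ ^ (3 / 4 : ℝ)) := by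
    intro w
    refine (hMbound _).trans ?_
    rw [← Real.exp_add, Real.exp_le_exp,
      show (2⁻¹ : ℂ) = ((2⁻¹ : ℝ) : ℂ) by push_cast; ring, Complex.norm_cpow_real]
    linarith [mul_sqrt_le_rpow_add_cube hR (norm_nonneg w)]
  -- Hadamard in genus zero
  obtain ⟨b, hbsum, hprod⟩ := hH G (3 / 4) (Real.exp (R ^ 3)) hGdiff (by norm_num) hGbound
    (by rw [hG0]; exact one_ne_zero)
  simp only [hG0, div_one] at hprod
  -- Lee–Yang: every `b n` is a non-positive real
  have hb : ∀ n, (b n).im = 0 ∧ (b n).re ≤ 0 := by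
    intro n
    by_cases hbn : b n = 0
    · simp [hbn]
    set w₀ : ℂ := (b n)⁻¹ with hw₀
    have hfac : 1 - b n * w₀ = 0 := by rw [hw₀, mul_inv_cancel₀ hbn, sub_self]
    have hGw : G w₀ = 0 := eq_zero_of_hasProd_of_eq_zero (hprod w₀) hfac
    set ζ : ℂ := w₀ ^ (2⁻¹ : ℂ) with hζ
    have hre : ζ.re = 0 := hLY ζ hGw
    have hw' : w₀ = ζ ^ 2 := (Complex.cpow_ofNat_inv_pow w₀ 2).symm
    have hζ' : ζ = (ζ.im : ℂ) * I := by
      apply Complex.ext <;> simp [hre]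
    have hw₀val : w₀ = -((ζ.im ^ 2 : ℝ) : ℂ) := by
      have h2 : ζ ^ 2 = -((ζ.im ^ 2 : ℝ) : ℂ) := by
        conv_lhs => rw [hζ']
        rw [mul_pow, Complex.I_sq]; push_cast; ring
      rw [hw', h2]
    have him0 : ζ.im ≠ 0 := by
      intro h0
      have : w₀ = 0 := by rw [hw₀val, h0]; simp
      exact inv_ne_zero hbn this
    have hbval : b n = ((-(ζ.im ^ 2)⁻¹ : ℝ) : ℂ) := by
      have : b n = w₀⁻¹ := by rw [hw₀, inv_inv]
      rw [this, hw₀val]; push_cast; ring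
    rw [hbval, Complex.ofReal_im, Complex.ofReal_re]
    exact ⟨rfl, neg_nonpos.2 (inv_nonneg.2 (sq_nonneg _))⟩
  -- the non-negative reals `β n = -b n`
  set β : ℕ → ℝ := fun n => -(b n).re with hβ
  have hβ0 : ∀ n, 0 ≤ β n := fun n => by simp only [hβ]; linarith [(hb n).2]
  have hbβ : ∀ n, b n = -(β n : ℂ) := fun n => by
    apply Complex.ext
    · simp [hβ]
    · simp [hβ, (hb n).1]
  have hβsum : Summable β := by
    refine Summable.of_nonneg_of_le hβ0 (fun n => ?_) hbsum
    simp only [hβ]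
    calc -(b n).re ≤ |(b n).re| := neg_le_abs _
      _ ≤ ‖b n‖ := Complex.abs_re_le_norm _
  have hprodM : ∀ z : ℂ, HasProd (fun n => 1 + (β n : ℂ) * z ^ 2) (M z) := by
    intro z
    have h := hprod (z ^ 2)
    rw [hGsq] at h
    convert h using 2 with n
    rw [hbβ]; ring
  -- the index set of genuine factors and Newman's `α_j = β_j^{-1/2}`
  let J : Set ℕ := {n | β n ≠ 0}
  refine ⟨J, fun j => (Real.sqrt (β j))⁻¹, fun j => ?_, ?_, fun z => ?_⟩
  · have hj : 0 < β j := lt_of_le_of_ne (hβ0 j) (fun h => j.2 h.symm)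
    exact inv_pos.2 (Real.sqrt_pos.2 hj)
  · have e : (fun j : J => ((Real.sqrt (β j))⁻¹ ^ 2)⁻¹) = fun j : J => β j := by
      funext j
      rw [inv_pow, inv_inv, Real.sq_sqrt (hβ0 j)]
    rw [e]
    exact hβsum.subtype J
  · rw [hint, ← (hprodM z).tprod_eq]
    have e : ∀ j : J, (1 + (z / ((Real.sqrt (β j))⁻¹ : ℝ)) ^ 2 : ℂ) = 1 + (β j : ℂ) * z ^ 2 := by
      intro j
      have hj : 0 < β j := lt_of_le_of_ne (hβ0 j) (fun h => j.2 h.symm)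
      have hs : (Real.sqrt (β j) : ℂ) ^ 2 = β j := by
        rw [← Complex.ofReal_pow, Real.sq_sqrt hj.le]
      have hsne : (Real.sqrt (β j) : ℂ) ≠ 0 := Complex.ofReal_ne_zero.2 (Real.sqrt_pos.2 hj).ne'
      push_cast
      rw [div_inv_eq_mul, mul_pow, hs]
      ring
    simp_rw [e]
    rw [tprod_subtype J (fun n => 1 + (β n : ℂ) * z ^ 2), Set.mulIndicator_eq_self.2]
    intro n hn
    simp only [Function.mem_mulSupport] at hn
    intro h0
    apply hn
    simp [h0]


end HierarchicalRG

open HierarchicalRG in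
/-- **HHW Appendix A, (A.1) with §2.2 — the named fact `HaraHattoriWatanabe2001_eqA1`, PROVED**
(`d = 4`, `c = √2`, every `s ≥ 0` and `N`; `b = 0`).
[cite: HaraHattoriWatanabe2001, Appendix A eq. (A.1) and §2.2 (p. 5)]
[cite: Newman1975, Proposition 2 and Theorem 1] -/
theorem HaraHattoriWatanabe2001_eqA1_holds : HaraHattoriWatanabe2001_eqA1 := by
  intro s hs N
  obtain ⟨ι, α, hα, hsum, hrepr⟩ := exists_newmanRepr_iterate
    Literature.Analysis.Complex.hadamard_genus_zero_holds (Real.sqrt 2) s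
    (Real.sqrt_pos.2 two_pos) sqrt_two_le_two hs N
  refine ⟨ι, 0, α, le_rfl, hα, hsum, fun z => ?_⟩
  rw [show traj s N = (rgMap (Real.sqrt 2))^[N] (IsingStrongCouplingLimit.isingLaw s) from rfl,
    hrepr z]
  simp

end Literature.Barriers.CriticalPhenomena

end
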